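import Literature.NumberTheory.EllipticCurves.GaussianLatticeHeckeLValue
import Literature.NumberTheory.EllipticCurves.GaussianLatticeThirdValues
import Literature.NumberTheory.LFunctions.GaussianThetaFunctionalEquation
import HarnessLib

/-!
# STUB-PLAN P6 (assembly), part A — Chinese-remainder regrouping of the finite Eisenstein–Kronecker sum modulo `3M'`
# into `χ₄^k`-weighted `3`-torsion sums of `E₁*`

Summit `BirchSwinnertonDyer`, crux `InertBadAtThree` (stmt-BirchSwinnertonDyer-19225; K8 `InertBadSignedBranches` r4 / BED
`BiquadraticEisensteinDescent` r5), line of record `Cruxes/InertBadAtThree/Lines/rubin_e1_inert_three.lean` v5 (lead `bsd-line-ibd-p1`),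
registered stub `stub_plainOddNeronIntegralThreeQuartic`; STUB-PLAN `Cruxes/InertBadAtThree/STUB-PLAN-neronIntegralThreeQuartic-bsd-idea-18-g8.md`
piece **P6 `stub_clean_of_dictionary`** (the CRT bookkeeping), first half. Lead bsd-line-ibd-p1 g7 (`--supports 19225`, helper).

THE COMPUTATION. The tree's finite formula `GaussianLattice.thetaLFunction_one_eq_sum_kroneckerE₁` writes a weight-one theta
`L`-value of `ℚ(i)` as `M⁻¹ Σ_{c mod M} Φ(c) E₁*(conj(c/M))`. For the quartic twists `y² = x³ + Ax`, `3 ∣ A`, the coefficient is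
`Φ = conj(χ₄)^k · Ψ'`, `χ₄ = (·/3)₄` the quartic symbol at the inert `3` (`k = v₃(A)`), `Ψ'` periodic modulo `M'` prime to `3`,
`M = 3M'`. We regroup along `ℤ[i]/3M' ≃ ℤ[i]/3 × ℤ[i]/M'`. §2: the weight `χ₄` is carried as a HYPOTHESIS SHAPE
`hq : ∀ x, q x = [residue table]` (any definition with this table discharges it by unfolding). §3 **`inner_sum`**: for `k ≥ 1` and
`α` prime to `3`, `Σ_{a mod 3} conj(q(a))^k E₁*(w + α·conj(a)/3) = [E₁*(w ± 1/3)] + (−1)^k[E₁*(w ± i/3)] + i^k[E₁*(w ± (1−i)/3)]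
+ (−i)^k[E₁*(w ± (1+i)/3)]` (`k = 1`: the `χ₄`-sum of `…QuarticTorsionSums.quarticSum_eq`; `k = 2`: the tree's
`threeTorsionTwistedSum`; `k = 3`: the `χ̄₄`-sum). §4 **`sum_classes_three_mul_eq_sum_torsion`**: for `(3, M') = 1`, `αM' + 3β = 1`,
`Ψ'` periodic modulo `M'`: `Σ_{c mod 3M'} conj(q(c))^k Ψ'(c) E₁*(conj(classDiv c)) = Σ_{b mod M'} Ψ'(b) · R_k(β·conj(b)/M')`
(`crtPairEquiv`, `apply_eq_of_cls_eq`; the representative modulo `3M'` is `αM'·a + 3β·b + 3M'·z`). Part B (separate file) adds the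
termwise `3`-integrality (P6a–c) and the model periods (P2). HONEST FRAMING: identities between finite sums of Eisenstein–Kronecker
numbers; nothing here proves the stub, the crux or BSD. No definitions, no named facts, no `sorry`; axioms standard.
-/

set_option linter.dupNamespace false
set_option autoImplicit false

noncomputable section

open scoped ComplexConjugate
open Complex PeriodPair
open Literature.NumberTheory.EllipticCurves Literature.NumberTheory.EllipticCurves.GaussianLattice
open Literature.NumberTheory.LFunctions Literature.NumberTheory.LFunctions.GaussianTheta

namespace Summit.BirchSwinnertonDyer.BirchSwinnertonDyer.Theorems.InertBadSignedBranchesInertBadAtThreeQuarticCleanAssembly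

/-! ## §1 Lattice bookkeeping for `E₁*` -/

/-- A Gaussian integer is a point of `Λ = ℤi + ℤ`. [folklore] -/
theorem toComplex_mem_lattice (x : GaussianInt) : ((x : GaussianInt) : ℂ) ∈ (ofUpperHalfPlane UpperHalfPlane.I).lattice :=
  GaussianLattice.mem_lattice_iff.mpr ⟨x.im, x.re, by rw [GaussianInt.toComplex_def]; ring⟩

/-- `E₁*(z + (m i + n)) = E₁*(z)` for integers `m, n`. [folklore] -/
theorem kroneckerE₁_add_int_mul_I_add_int (z : ℂ) (m n : ℤ) :
    kroneckerE₁ (z + ((m : ℂ) * I + n)) = kroneckerE₁ z :=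
  kroneckerE₁_add_of_mem z (GaussianLattice.mem_lattice_iff.mpr ⟨m, n, rfl⟩)

/-! ## §2 The quartic residue symbol modulo `3` as a table (hypothesis shape `hq`) -/

section Table

variable {q : GaussianInt → ℂ}
  (hq : ∀ x : GaussianInt, q x =
    if (3 : ℤ) ∣ x.re ∧ (3 : ℤ) ∣ x.im then 0
    else if (3 : ℤ) ∣ x.im then 1
    else if (3 : ℤ) ∣ x.re then -1
    else if (3 : ℤ) ∣ x.re - x.im then -I
    else I)

include hq

/-- `q` is periodic modulo `3`. [folklore] -/
theorem table_add_three_mul (x y : GaussianInt) : q (x + 3 * y) = q x := by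
  have h3 : (3 : GaussianInt) = ⟨3, 0⟩ := rfl
  have hre : (x + 3 * y).re = x.re + 3 * y.re := by rw [h3]; simp [Zsqrtd.re_add, Zsqrtd.re_mul]
  have him : (x + 3 * y).im = x.im + 3 * y.im := by rw [h3]; simp [Zsqrtd.im_add, Zsqrtd.im_mul]
  have e1 : (3 : ℤ) ∣ (x + 3 * y).re ↔ (3 : ℤ) ∣ x.re := by
    rw [hre]; exact dvd_add_left (dvd_mul_right 3 y.re)
  have e2 : (3 : ℤ) ∣ (x + 3 * y).im ↔ (3 : ℤ) ∣ x.im := by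
    rw [him]; exact dvd_add_left (dvd_mul_right 3 y.im)
  have e3 : (3 : ℤ) ∣ (x + 3 * y).re - (x + 3 * y).im ↔ (3 : ℤ) ∣ x.re - x.im := by
    rw [hre, him, show x.re + 3 * y.re - (x.im + 3 * y.im) = x.re - x.im + 3 * (y.re - y.im) by ring]
    exact dvd_add_left (dvd_mul_right 3 _)
  rw [hq, hq x]
  simp only [e1, e2, e3]

/-- `q(−x) = q(x)`. [folklore] -/
theorem table_neg (x : GaussianInt) : q (-x) = q x := by
  have e3 : (3 : ℤ) ∣ -x.re - -x.im ↔ (3 : ℤ) ∣ x.re - x.im := by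
    rw [show -x.re - -x.im = -(x.re - x.im) by ring, dvd_neg]
  rw [hq, hq x]
  simp only [Zsqrtd.re_neg, Zsqrtd.im_neg, dvd_neg, e3]

/-- The nine values of `q` on the canonical representatives modulo `3`. [folklore] -/
theorem table_values :
    q ⟨0, 0⟩ = 0 ∧ q ⟨1, 0⟩ = 1 ∧ q ⟨2, 0⟩ = 1 ∧ q ⟨0, 1⟩ = -1 ∧ q ⟨0, 2⟩ = -1 ∧
      q ⟨1, 1⟩ = -I ∧ q ⟨2, 2⟩ = -I ∧ q ⟨1, 2⟩ = I ∧ q ⟨2, 1⟩ = I := by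
  refine ⟨?_, ?_, ?_, ?_, ?_, ?_, ?_, ?_, ?_⟩ <;> (rw [hq]; norm_num)

end Table

/-! ## §3 The inner sum over `ℤ[i]/3`: nine terms -/

/-- Expansion of a sum over `ZMod 3`. [folklore] -/
theorem sum_univ_zmod_three (g : ZMod 3 → ℂ) : ∑ a : ZMod 3, g a = g 0 + g 1 + g 2 := by
  rw [show (Finset.univ : Finset (ZMod 3)) = {0, 1, 2} by decide, Finset.sum_insert (by decide),
    Finset.sum_insert (by decide), Finset.sum_singleton]
  ring

/-- Expansion of a sum over `ℤ[i]/3` into its nine representatives. [folklore] -/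
theorem sum_zmod_three_prod (f : ZMod 3 × ZMod 3 → ℂ) :
    ∑ c : ZMod 3 × ZMod 3, f c =
      f (0, 0) + f (0, 1) + f (0, 2) + (f (1, 0) + f (1, 1) + f (1, 2)) + (f (2, 0) + f (2, 1) + f (2, 2)) := by
  rw [Fintype.sum_prod_type, sum_univ_zmod_three]
  simp only [sum_univ_zmod_three]

/-- The representatives `rep 3 (a, b) 0 = ⟨a, b⟩`. [folklore] -/
theorem rep_three_values :
    rep 3 ((0 : ZMod 3), (0 : ZMod 3)) 0 = ⟨0, 0⟩ ∧ rep 3 ((0 : ZMod 3), (1 : ZMod 3)) 0 = ⟨0, 1⟩ ∧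
    rep 3 ((0 : ZMod 3), (2 : ZMod 3)) 0 = ⟨0, 2⟩ ∧ rep 3 ((1 : ZMod 3), (0 : ZMod 3)) 0 = ⟨1, 0⟩ ∧
    rep 3 ((1 : ZMod 3), (1 : ZMod 3)) 0 = ⟨1, 1⟩ ∧ rep 3 ((1 : ZMod 3), (2 : ZMod 3)) 0 = ⟨1, 2⟩ ∧
    rep 3 ((2 : ZMod 3), (0 : ZMod 3)) 0 = ⟨2, 0⟩ ∧ rep 3 ((2 : ZMod 3), (1 : ZMod 3)) 0 = ⟨2, 1⟩ ∧
    rep 3 ((2 : ZMod 3), (2 : ZMod 3)) 0 = ⟨2, 2⟩ := by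
  refine ⟨?_, ?_, ?_, ?_, ?_, ?_, ?_, ?_, ?_⟩ <;> decide

/-- `conj (a + b i) = a − b i` for a Gaussian integer given by its coordinates. [folklore] -/
theorem conj_toComplex_mk (a b : ℤ) : conj (((⟨a, b⟩ : GaussianInt)) : ℂ) = (a : ℂ) - (b : ℂ) * I := by
  rw [GaussianInt.toComplex_def']; simp only [map_add, map_mul, map_intCast, Complex.conj_I]; ring

section Inner

variable {q : GaussianInt → ℂ}
  (hq : ∀ x : GaussianInt, q x =
    if (3 : ℤ) ∣ x.re ∧ (3 : ℤ) ∣ x.im then 0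
    else if (3 : ℤ) ∣ x.im then 1
    else if (3 : ℤ) ∣ x.re then -1
    else if (3 : ℤ) ∣ x.re - x.im then -I
    else I)

include hq

/-- **The inner sum, case `α ≡ 1 (mod 3)`.** For `k ≥ 1` and `α = 3t + 1`:
`Σ_{a mod 3} conj(q(a))^k E₁*(w + α conj(a)/3) = R_k(w)`. [folklore] -/
theorem inner_sum_of_eq_three_mul_add_one {k : ℕ} (hk : k ≠ 0) (w : ℂ) {α t : ℤ} (ht : α = 3 * t + 1) :
    ∑ a : ZMod 3 × ZMod 3, (conj (q (rep 3 a 0))) ^ k *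
        kroneckerE₁ (w + (α : ℂ) * conj ((rep 3 a 0 : GaussianInt) : ℂ) / 3) =
      (kroneckerE₁ (w + 1 / 3) + kroneckerE₁ (w - 1 / 3)) +
        (-1 : ℂ) ^ k * (kroneckerE₁ (w + I / 3) + kroneckerE₁ (w - I / 3)) +
        I ^ k * (kroneckerE₁ (w + (1 - I) / 3) + kroneckerE₁ (w - (1 - I) / 3)) +
        (-I) ^ k * (kroneckerE₁ (w + (1 + I) / 3) + kroneckerE₁ (w - (1 + I) / 3)) := by
  obtain ⟨r00, r01, r02, r10, r11, r12, r20, r21, r22⟩ := rep_three_values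
  obtain ⟨v00, v10, v20, v01, v02, v11, v22, v12, v21⟩ := table_values hq
  have hα : (α : ℂ) = 3 * t + 1 := by rw [ht]; push_cast; ring
  rw [sum_zmod_three_prod]
  simp only [r00, r01, r02, r10, r11, r12, r20, r21, r22, v00, v10, v20, v01, v02, v11, v22, v12, v21,
    map_zero, map_one, map_neg, Complex.conj_I, neg_neg, zero_pow hk, zero_mul, zero_add, conj_toComplex_mk]
  push_cast
  have h10 : kroneckerE₁ (w + (α : ℂ) * (1 - 0 * I) / 3) = kroneckerE₁ (w + 1 / 3) := by
    rw [show w + (α : ℂ) * (1 - 0 * I) / 3 = (w + 1 / 3) + (((((0) : ℤ)) : ℂ) * I + (((t) : ℤ) : ℂ)) by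
      rw [hα]; push_cast; ring]
    exact kroneckerE₁_add_int_mul_I_add_int _ _ _
  have h20 : kroneckerE₁ (w + (α : ℂ) * (2 - 0 * I) / 3) = kroneckerE₁ (w - 1 / 3) := by
    rw [show w + (α : ℂ) * (2 - 0 * I) / 3 = (w - 1 / 3) + (((((0) : ℤ)) : ℂ) * I + (((2 * t + 1) : ℤ) : ℂ)) by
      rw [hα]; push_cast; ring]
    exact kroneckerE₁_add_int_mul_I_add_int _ _ _
  have h01 : kroneckerE₁ (w + (α : ℂ) * (0 - 1 * I) / 3) = kroneckerE₁ (w - I / 3) := by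
    rw [show w + (α : ℂ) * (0 - 1 * I) / 3 = (w - I / 3) + (((((-t) : ℤ)) : ℂ) * I + (((0) : ℤ) : ℂ)) by
      rw [hα]; push_cast; ring]
    exact kroneckerE₁_add_int_mul_I_add_int _ _ _
  have h02 : kroneckerE₁ (w + (α : ℂ) * (0 - 2 * I) / 3) = kroneckerE₁ (w + I / 3) := by
    rw [show w + (α : ℂ) * (0 - 2 * I) / 3 = (w + I / 3) + (((((-(2 * t + 1)) : ℤ)) : ℂ) * I + (((0) : ℤ) : ℂ)) by
      rw [hα]; push_cast; ring]
    exact kroneckerE₁_add_int_mul_I_add_int _ _ _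
  have h11 : kroneckerE₁ (w + (α : ℂ) * (1 - 1 * I) / 3) = kroneckerE₁ (w + (1 - I) / 3) := by
    rw [show w + (α : ℂ) * (1 - 1 * I) / 3 = (w + (1 - I) / 3) + (((((-t) : ℤ)) : ℂ) * I + (((t) : ℤ) : ℂ)) by
      rw [hα]; push_cast; ring]
    exact kroneckerE₁_add_int_mul_I_add_int _ _ _
  have h22 : kroneckerE₁ (w + (α : ℂ) * (2 - 2 * I) / 3) = kroneckerE₁ (w - (1 - I) / 3) := by
    rw [show w + (α : ℂ) * (2 - 2 * I) / 3 = (w - (1 - I) / 3) + (((((-(2 * t + 1)) : ℤ)) : ℂ) * I + (((2 * t + 1) : ℤ) : ℂ)) by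
      rw [hα]; push_cast; ring]
    exact kroneckerE₁_add_int_mul_I_add_int _ _ _
  have h12 : kroneckerE₁ (w + (α : ℂ) * (1 - 2 * I) / 3) = kroneckerE₁ (w + (1 + I) / 3) := by
    rw [show w + (α : ℂ) * (1 - 2 * I) / 3 = (w + (1 + I) / 3) + (((((-(2 * t + 1)) : ℤ)) : ℂ) * I + (((t) : ℤ) : ℂ)) by
      rw [hα]; push_cast; ring]
    exact kroneckerE₁_add_int_mul_I_add_int _ _ _
  have h21 : kroneckerE₁ (w + (α : ℂ) * (2 - 1 * I) / 3) = kroneckerE₁ (w - (1 + I) / 3) := by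
    rw [show w + (α : ℂ) * (2 - 1 * I) / 3 = (w - (1 + I) / 3) + (((((-t) : ℤ)) : ℂ) * I + (((2 * t + 1) : ℤ) : ℂ)) by
      rw [hα]; push_cast; ring]
    exact kroneckerE₁_add_int_mul_I_add_int _ _ _
  rw [h10, h20, h01, h02, h11, h22, h12, h21, one_pow]
  ring

/-- **The inner sum, case `α ≡ −1 (mod 3)`.** For `k ≥ 1` and `α = 3t − 1`: the same value `R_k(w)`. [folklore] -/
theorem inner_sum_of_eq_three_mul_sub_one {k : ℕ} (hk : k ≠ 0) (w : ℂ) {α t : ℤ} (ht : α = 3 * t - 1) :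
    ∑ a : ZMod 3 × ZMod 3, (conj (q (rep 3 a 0))) ^ k *
        kroneckerE₁ (w + (α : ℂ) * conj ((rep 3 a 0 : GaussianInt) : ℂ) / 3) =
      (kroneckerE₁ (w + 1 / 3) + kroneckerE₁ (w - 1 / 3)) +
        (-1 : ℂ) ^ k * (kroneckerE₁ (w + I / 3) + kroneckerE₁ (w - I / 3)) +
        I ^ k * (kroneckerE₁ (w + (1 - I) / 3) + kroneckerE₁ (w - (1 - I) / 3)) +
        (-I) ^ k * (kroneckerE₁ (w + (1 + I) / 3) + kroneckerE₁ (w - (1 + I) / 3)) := by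
  obtain ⟨r00, r01, r02, r10, r11, r12, r20, r21, r22⟩ := rep_three_values
  obtain ⟨v00, v10, v20, v01, v02, v11, v22, v12, v21⟩ := table_values hq
  have hα : (α : ℂ) = 3 * t - 1 := by rw [ht]; push_cast; ring
  rw [sum_zmod_three_prod]
  simp only [r00, r01, r02, r10, r11, r12, r20, r21, r22, v00, v10, v20, v01, v02, v11, v22, v12, v21,
    map_zero, map_one, map_neg, Complex.conj_I, neg_neg, zero_pow hk, zero_mul, zero_add, conj_toComplex_mk]
  push_cast
  have h10 : kroneckerE₁ (w + (α : ℂ) * (1 - 0 * I) / 3) = kroneckerE₁ (w - 1 / 3) := by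
    rw [show w + (α : ℂ) * (1 - 0 * I) / 3 = (w - 1 / 3) + (((((0) : ℤ)) : ℂ) * I + (((t) : ℤ) : ℂ)) by
      rw [hα]; push_cast; ring]
    exact kroneckerE₁_add_int_mul_I_add_int _ _ _
  have h20 : kroneckerE₁ (w + (α : ℂ) * (2 - 0 * I) / 3) = kroneckerE₁ (w + 1 / 3) := by
    rw [show w + (α : ℂ) * (2 - 0 * I) / 3 = (w + 1 / 3) + (((((0) : ℤ)) : ℂ) * I + (((2 * t - 1) : ℤ) : ℂ)) by
      rw [hα]; push_cast; ring]
    exact kroneckerE₁_add_int_mul_I_add_int _ _ _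
  have h01 : kroneckerE₁ (w + (α : ℂ) * (0 - 1 * I) / 3) = kroneckerE₁ (w + I / 3) := by
    rw [show w + (α : ℂ) * (0 - 1 * I) / 3 = (w + I / 3) + (((((-t) : ℤ)) : ℂ) * I + (((0) : ℤ) : ℂ)) by
      rw [hα]; push_cast; ring]
    exact kroneckerE₁_add_int_mul_I_add_int _ _ _
  have h02 : kroneckerE₁ (w + (α : ℂ) * (0 - 2 * I) / 3) = kroneckerE₁ (w - I / 3) := by
    rw [show w + (α : ℂ) * (0 - 2 * I) / 3 = (w - I / 3) + (((((1 - 2 * t) : ℤ)) : ℂ) * I + (((0) : ℤ) : ℂ)) by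
      rw [hα]; push_cast; ring]
    exact kroneckerE₁_add_int_mul_I_add_int _ _ _
  have h11 : kroneckerE₁ (w + (α : ℂ) * (1 - 1 * I) / 3) = kroneckerE₁ (w - (1 - I) / 3) := by
    rw [show w + (α : ℂ) * (1 - 1 * I) / 3 = (w - (1 - I) / 3) + (((((-t) : ℤ)) : ℂ) * I + (((t) : ℤ) : ℂ)) by
      rw [hα]; push_cast; ring]
    exact kroneckerE₁_add_int_mul_I_add_int _ _ _
  have h22 : kroneckerE₁ (w + (α : ℂ) * (2 - 2 * I) / 3) = kroneckerE₁ (w + (1 - I) / 3) := by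
    rw [show w + (α : ℂ) * (2 - 2 * I) / 3 = (w + (1 - I) / 3) + (((((1 - 2 * t) : ℤ)) : ℂ) * I + (((2 * t - 1) : ℤ) : ℂ)) by
      rw [hα]; push_cast; ring]
    exact kroneckerE₁_add_int_mul_I_add_int _ _ _
  have h12 : kroneckerE₁ (w + (α : ℂ) * (1 - 2 * I) / 3) = kroneckerE₁ (w - (1 + I) / 3) := by
    rw [show w + (α : ℂ) * (1 - 2 * I) / 3 = (w - (1 + I) / 3) + (((((1 - 2 * t) : ℤ)) : ℂ) * I + (((t) : ℤ) : ℂ)) by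
      rw [hα]; push_cast; ring]
    exact kroneckerE₁_add_int_mul_I_add_int _ _ _
  have h21 : kroneckerE₁ (w + (α : ℂ) * (2 - 1 * I) / 3) = kroneckerE₁ (w + (1 + I) / 3) := by
    rw [show w + (α : ℂ) * (2 - 1 * I) / 3 = (w + (1 + I) / 3) + (((((-t) : ℤ)) : ℂ) * I + (((2 * t - 1) : ℤ) : ℂ)) by
      rw [hα]; push_cast; ring]
    exact kroneckerE₁_add_int_mul_I_add_int _ _ _
  rw [h10, h20, h01, h02, h11, h22, h12, h21, one_pow]
  ring

/-- **The inner sum for any `α` prime to `3`** (`k ≥ 1`): `Σ_{a mod 3} conj(q(a))^k E₁*(w + α conj(a)/3) = R_k(w)`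
— the substitution `v = α conj(a)` permutes `(ℤ[i]/3)ˣ` and `χ₄(α) = α² ≡ 1`. [folklore] -/
theorem inner_sum {k : ℕ} (hk : k ≠ 0) (w : ℂ) {α : ℤ} (hα : ¬ (3 : ℤ) ∣ α) :
    ∑ a : ZMod 3 × ZMod 3, (conj (q (rep 3 a 0))) ^ k *
        kroneckerE₁ (w + (α : ℂ) * conj ((rep 3 a 0 : GaussianInt) : ℂ) / 3) =
      (kroneckerE₁ (w + 1 / 3) + kroneckerE₁ (w - 1 / 3)) +
        (-1 : ℂ) ^ k * (kroneckerE₁ (w + I / 3) + kroneckerE₁ (w - I / 3)) +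
        I ^ k * (kroneckerE₁ (w + (1 - I) / 3) + kroneckerE₁ (w - (1 - I) / 3)) +
        (-I) ^ k * (kroneckerE₁ (w + (1 + I) / 3) + kroneckerE₁ (w - (1 + I) / 3)) := by
  have h : ∃ t : ℤ, α = 3 * t + 1 ∨ α = 3 * t - 1 := by
    refine ⟨if α % 3 = 1 then α / 3 else α / 3 + 1, ?_⟩
    have h3 := Int.emod_emod_of_dvd α (dvd_refl (3 : ℤ))
    split_ifs with h1 <;> omega
  obtain ⟨t, ht | ht⟩ := h
  · exact inner_sum_of_eq_three_mul_add_one hq hk w ht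
  · exact inner_sum_of_eq_three_mul_sub_one hq hk w ht

end Inner

/-! ## §4 Chinese remainder: the finite-formula sum modulo `3M'` regrouped over `ℤ[i]/M'` -/

section CRT

variable {M' : ℕ} [NeZero M'] [NeZero (3 * M')]

omit [NeZero M'] [NeZero (3 * M')] in
/-- **CRT decomposition of a representative modulo `3M'`.** For `(3, M') = 1` and integers `α, β` with `αM' + 3β = 1`,
the canonical representative of a class `c` modulo `3M'` is `αM'·a + 3β·b + 3M'·z` with `a`, `b` the canonical
representatives of `c mod 3`, `c mod M'` and some `z ∈ ℤ[i]`. [folklore] -/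
theorem exists_rep_three_mul_eq (h3 : Nat.Coprime 3 M') {α β : ℤ} (hαβ : α * M' + 3 * β = 1)
    (c : ZMod (3 * M') × ZMod (3 * M')) :
    ∃ z : GaussianInt, rep (3 * M') c 0 =
      (α * M' : ℤ) * rep 3 ((c.1.val : ZMod 3), (c.2.val : ZMod 3)) 0 +
        (3 * β : ℤ) * rep M' ((c.1.val : ZMod M'), (c.2.val : ZMod M')) 0 + (3 * M' : ℕ) * z := by
  have hcop : IsCoprime (3 : ℤ) (M' : ℤ) := by
    rw [Int.isCoprime_iff_gcd_eq_one, show (3 : ℤ) = ((3 : ℕ) : ℤ) by rfl, Int.gcd_natCast_natCast]; exact h3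
  -- one coordinate
  have key : ∀ X : ℕ, ∃ z : ℤ, (X : ℤ) = α * M' * (((X : ZMod 3).val : ℕ) : ℤ) +
      3 * β * (((X : ZMod M').val : ℕ) : ℤ) + (3 * M' : ℕ) * z := by
    intro X
    rw [ZMod.val_natCast, ZMod.val_natCast]
    have hd3 : (3 : ℤ) ∣ (X : ℤ) - α * M' * ((X % 3 : ℕ) : ℤ) - 3 * β * ((X % M' : ℕ) : ℤ) := by
      refine ⟨(X / 3 : ℕ) + β * ((X % 3 : ℕ) : ℤ) - β * ((X % M' : ℕ) : ℤ), ?_⟩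
      have hX : ((X : ℕ) : ℤ) = 3 * ((X / 3 : ℕ) : ℤ) + ((X % 3 : ℕ) : ℤ) := by exact_mod_cast (Nat.div_add_mod X 3).symm
      linear_combination hX - (((X % 3 : ℕ) : ℤ)) * hαβ
    have hdM : (M' : ℤ) ∣ (X : ℤ) - α * M' * ((X % 3 : ℕ) : ℤ) - 3 * β * ((X % M' : ℕ) : ℤ) := by
      refine ⟨(X / M' : ℕ) - α * ((X % 3 : ℕ) : ℤ) + α * ((X % M' : ℕ) : ℤ), ?_⟩
      have hX : ((X : ℕ) : ℤ) = M' * ((X / M' : ℕ) : ℤ) + ((X % M' : ℕ) : ℤ) := by exact_mod_cast (Nat.div_add_mod X M').symm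
      linear_combination hX - (((X % M' : ℕ) : ℤ)) * hαβ
    obtain ⟨z, hz⟩ := hcop.mul_dvd hd3 hdM
    refine ⟨z, ?_⟩
    have h3M : ((3 * M' : ℕ) : ℤ) = 3 * (M' : ℤ) := by push_cast; ring
    rw [h3M]
    linear_combination hz
  obtain ⟨z₁, hz₁⟩ := key c.1.val
  obtain ⟨z₂, hz₂⟩ := key c.2.val
  refine ⟨⟨z₁, z₂⟩, Zsqrtd.ext ?_ ?_⟩
  · simp only [rep_re, rep_im, Zsqrtd.re_add, Zsqrtd.re_mul, Zsqrtd.re_intCast, Zsqrtd.im_intCast,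
      Zsqrtd.re_natCast, Zsqrtd.im_natCast, Prod.fst_zero, Prod.snd_zero, mul_zero, add_zero, zero_mul]
    linear_combination hz₁
  · simp only [rep_re, rep_im, Zsqrtd.im_add, Zsqrtd.im_mul, Zsqrtd.re_intCast, Zsqrtd.im_intCast,
      Zsqrtd.re_natCast, Zsqrtd.im_natCast, Prod.fst_zero, Prod.snd_zero, mul_zero, add_zero, zero_mul]
    linear_combination hz₂

omit [NeZero (3 * M')] in
/-- **The Eisenstein–Kronecker number of a class modulo `3M'` splits along CRT**: with `αM' + 3β = 1`,
`E₁*(conj(c/(3M'))) = E₁*(β conj(b)/M' + α conj(a)/3)` (`a = c mod 3`, `b = c mod M'`; `E₁*` is `Λ`-periodic). [folklore] -/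
theorem kroneckerE₁_conj_classDiv_eq (h3 : Nat.Coprime 3 M') {α β : ℤ} (hαβ : α * M' + 3 * β = 1)
    (c : ZMod (3 * M') × ZMod (3 * M')) :
    kroneckerE₁ (conj (classDiv (3 * M') c)) =
      kroneckerE₁ ((β : ℂ) * conj ((rep M' ((c.1.val : ZMod M'), (c.2.val : ZMod M')) 0 : GaussianInt) : ℂ) / M' +
        (α : ℂ) * conj ((rep 3 ((c.1.val : ZMod 3), (c.2.val : ZMod 3)) 0 : GaussianInt) : ℂ) / 3) := by
  obtain ⟨z, hz⟩ := exists_rep_three_mul_eq h3 hαβ c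
  have hM : (M' : ℂ) ≠ 0 := Nat.cast_ne_zero.mpr (NeZero.ne M')
  have hzC := congrArg GaussianInt.toComplex hz
  simp only [map_add, map_mul, map_intCast, map_natCast] at hzC
  have e : conj (classDiv (3 * M') c) =
      ((β : ℂ) * conj ((rep M' ((c.1.val : ZMod M'), (c.2.val : ZMod M')) 0 : GaussianInt) : ℂ) / M' +
        (α : ℂ) * conj ((rep 3 ((c.1.val : ZMod 3), (c.2.val : ZMod 3)) 0 : GaussianInt) : ℂ) / 3) +
        ((star z : GaussianInt) : ℂ) := by
    rw [classDiv_def, GaussianInt.toComplex_star, show GaussianInt.toComplex (rep (3 * M') c 0) = _ from hzC]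
    simp only [map_div₀, map_add, map_mul, map_natCast, map_intCast, map_ofNat, Nat.cast_mul, Nat.cast_ofNat]
    push_cast
    field_simp
    ring
  rw [e, kroneckerE₁_add_of_mem _ (toComplex_mem_lattice (star z))]

variable {q : GaussianInt → ℂ}
  (hq : ∀ x : GaussianInt, q x =
    if (3 : ℤ) ∣ x.re ∧ (3 : ℤ) ∣ x.im then 0
    else if (3 : ℤ) ∣ x.im then 1
    else if (3 : ℤ) ∣ x.re then -1
    else if (3 : ℤ) ∣ x.re - x.im then -I
    else I)

include hq

/-- **CRT regrouping of the finite Eisenstein–Kronecker sum.** For `(3, M') = 1`, `αM' + 3β = 1`, `Ψ` periodic modulo `M'`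
and `Φ = conj(q)^k · Ψ` (periodic modulo `3M'`):
`Σ_{c mod 3M'} Φ(c) E₁*(conj(c/3M')) = Σ_{b mod M'} Ψ(b) Σ_{a mod 3} conj(q(a))^k E₁*(β conj(b)/M' + α conj(a)/3)`. [folklore] -/
theorem sum_classes_three_mul_eq (h3 : Nat.Coprime 3 M') {α β : ℤ} (hαβ : α * M' + 3 * β = 1)
    (Ψ : GaussianInt → ℂ) (hΨ : ∀ x y : GaussianInt, Ψ (x + M' * y) = Ψ x) (k : ℕ) :
    ∑ c : ZMod (3 * M') × ZMod (3 * M'),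
        (conj (q (rep (3 * M') c 0))) ^ k * Ψ (rep (3 * M') c 0) * kroneckerE₁ (conj (classDiv (3 * M') c)) =
      ∑ b : ZMod M' × ZMod M', Ψ (rep M' b 0) *
        ∑ a : ZMod 3 × ZMod 3, (conj (q (rep 3 a 0))) ^ k *
          kroneckerE₁ ((β : ℂ) * conj ((rep M' b 0 : GaussianInt) : ℂ) / M' +
            (α : ℂ) * conj ((rep 3 a 0 : GaussianInt) : ℂ) / 3) := by
  have hq3 : ∀ x y : GaussianInt, q (x + (3 : ℕ) * y) = q x := fun x y ↦ by
    rw [Nat.cast_ofNat]; exact table_add_three_mul hq x y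
  calc ∑ c : ZMod (3 * M') × ZMod (3 * M'),
        (conj (q (rep (3 * M') c 0))) ^ k * Ψ (rep (3 * M') c 0) * kroneckerE₁ (conj (classDiv (3 * M') c))
      = ∑ p : (ZMod 3 × ZMod 3) × (ZMod M' × ZMod M'), (conj (q (rep 3 p.1 0))) ^ k * Ψ (rep M' p.2 0) *
          kroneckerE₁ ((β : ℂ) * conj ((rep M' p.2 0 : GaussianInt) : ℂ) / M' +
            (α : ℂ) * conj ((rep 3 p.1 0 : GaussianInt) : ℂ) / 3) := by
        refine Fintype.sum_equiv (crtPairEquiv h3) _ _ fun c ↦ ?_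
        rw [crtPairEquiv_apply_fst, crtPairEquiv_apply_snd]
        have e1 : q (rep (3 * M') c 0) = q (rep 3 ((c.1.val : ZMod 3), (c.2.val : ZMod 3)) 0) :=
          apply_eq_of_cls_eq 3 hq3 (by simp [cls, rep])
        have e2 : Ψ (rep (3 * M') c 0) = Ψ (rep M' ((c.1.val : ZMod M'), (c.2.val : ZMod M')) 0) :=
          apply_eq_of_cls_eq M' hΨ (by simp [cls, rep])
        rw [e1, e2, kroneckerE₁_conj_classDiv_eq h3 hαβ c]
    _ = ∑ b : ZMod M' × ZMod M', Ψ (rep M' b 0) *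
        ∑ a : ZMod 3 × ZMod 3, (conj (q (rep 3 a 0))) ^ k *
          kroneckerE₁ ((β : ℂ) * conj ((rep M' b 0 : GaussianInt) : ℂ) / M' +
            (α : ℂ) * conj ((rep 3 a 0 : GaussianInt) : ℂ) / 3) := by
        rw [Fintype.sum_prod_type, Finset.sum_comm]
        refine Finset.sum_congr rfl fun b _ ↦ ?_
        rw [Finset.mul_sum]
        refine Finset.sum_congr rfl fun a _ ↦ ?_
        ring

/-- **The finite formula regrouped over the `3`-torsion** (`k ≥ 1`, `(3, M') = 1`, `3β ≡ 1 (mod M')`):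
`Σ_{c mod 3M'} conj(q(c))^k Ψ(c) E₁*(conj(c/3M')) = Σ_{b mod M'} Ψ(b) · R_k(β conj(b)/M')`, `R_k` the eight-term
`χ₄^k`-weighted sum of `E₁*` over the non-zero `3`-division points. [folklore] -/
theorem sum_classes_three_mul_eq_sum_torsion (h3 : Nat.Coprime 3 M') {α β : ℤ} (hαβ : α * M' + 3 * β = 1)
    (Ψ : GaussianInt → ℂ) (hΨ : ∀ x y : GaussianInt, Ψ (x + M' * y) = Ψ x) {k : ℕ} (hk : k ≠ 0) :
    ∑ c : ZMod (3 * M') × ZMod (3 * M'),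
        (conj (q (rep (3 * M') c 0))) ^ k * Ψ (rep (3 * M') c 0) * kroneckerE₁ (conj (classDiv (3 * M') c)) =
      ∑ b : ZMod M' × ZMod M', Ψ (rep M' b 0) *
        ((kroneckerE₁ ((β : ℂ) * conj ((rep M' b 0 : GaussianInt) : ℂ) / M' + 1 / 3) +
            kroneckerE₁ ((β : ℂ) * conj ((rep M' b 0 : GaussianInt) : ℂ) / M' - 1 / 3)) +
          (-1 : ℂ) ^ k * (kroneckerE₁ ((β : ℂ) * conj ((rep M' b 0 : GaussianInt) : ℂ) / M' + I / 3) +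
            kroneckerE₁ ((β : ℂ) * conj ((rep M' b 0 : GaussianInt) : ℂ) / M' - I / 3)) +
          I ^ k * (kroneckerE₁ ((β : ℂ) * conj ((rep M' b 0 : GaussianInt) : ℂ) / M' + (1 - I) / 3) +
            kroneckerE₁ ((β : ℂ) * conj ((rep M' b 0 : GaussianInt) : ℂ) / M' - (1 - I) / 3)) +
          (-I) ^ k * (kroneckerE₁ ((β : ℂ) * conj ((rep M' b 0 : GaussianInt) : ℂ) / M' + (1 + I) / 3) +
            kroneckerE₁ ((β : ℂ) * conj ((rep M' b 0 : GaussianInt) : ℂ) / M' - (1 + I) / 3))) := by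
  have hα : ¬ (3 : ℤ) ∣ α := by
    rintro ⟨u, hu⟩
    have : (3 : ℤ) ∣ 1 := ⟨u * M' + β, by rw [← hαβ, hu]; ring⟩
    omega
  rw [sum_classes_three_mul_eq hq h3 hαβ Ψ hΨ k]
  refine Finset.sum_congr rfl fun b _ ↦ ?_
  rw [inner_sum hq hk _ hα]

end CRT

end Summit.BirchSwinnertonDyer.BirchSwinnertonDyer.Theorems.InertBadSignedBranchesInertBadAtThreeQuarticCleanAssembly

end
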